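import Summits.ResolutionOfSingularities.ResolutionOfSingularities.Theorems.FrobeniusLadderFInjectiveMacaulayficationB9NewtonKFan
import Summits.ResolutionOfSingularities.ResolutionOfSingularities.Theorems.FrobeniusLadderFInjectiveMacaulayficationFHalfRowOfWeaklyNondegenerate
import Summits.ResolutionOfSingularities.ResolutionOfSingularities.Theorems.FrobeniusLadderFInjectiveMacaulayficationFHalfRowOfToricCoverData
import Summits.ResolutionOfSingularities.ResolutionOfSingularities.Theorems.FrobeniusLadderFInjectiveMacaulayficationCensusBedsWeaklyNondegenerate
import Summits.ResolutionOfSingularities.ResolutionOfSingularities.Theorems.FrobeniusLadderFInjectiveMacaulayficationB9PointFloorNotFull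
import Summits.ResolutionOfSingularities.ResolutionOfSingularities.Theorems.FrobeniusLadderFInjectiveMacaulayficationGermOfGlobalBlowup
import HarnessLib

/-!
# ★★★ BED B9 `z² + x⁹ + y⁹ + u⁹ + t⁹` — THE FIRST p-UNIFORM TWO-SIDED ROW OF THE F-HALF CENSUS (every prime `p ∤ 18`), BY THE CLASS THEOREM:
# the point floor of `Spec 𝒪_{X,v}` is LEGAL ∧ NOT FULL ∧ CURED by the monomial blowing up `𝔪·K` read off the `Σ_f ∧ Σ(𝔪)` fan (no Fedder cell, no strict-transform table)
# (crux `FInjectiveMacaulayfication` stmt-ResolutionOfSingularities-15315, chain w45a; res-L1-w45a-plan-1 RULING R22.7 (a)/(c) «B9: GO — the first F-side TWO-SIDED row not tied to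
# p ∈ {2,3}, through the CLASS ROUTE»; seat res-L1-w45a-stub-3 g12 TASK 2; input side = res-L1-w45a-stub-1 g13's ✓ p679294 `B9Specimen` + ✓ p679908 `B9PointFloorNotFull`;
# first-step memo res-L1-w45a-tri-2 g19 `B9-GENERIC-P-FSIDE-tri2.md`; cover data = this seat's kit job j320904 → ✓ `B9NewtonKTables` / `B9NewtonKChecks` / `B9NewtonKFan`)

[OURS · L1 W4.5a] Support file (`--supports stmt-ResolutionOfSingularities-15315 --as helper`); def-free, unconditional; replaces the role of NO printed item;
NOT a statement of the manuscript; AI-written (AI review is weaker than expert review).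

`X = Spec (k[X₀..X₄]/(f))`, `f = X4 ^ 2 + X0 ^ 9 + X1 ^ 9 + X2 ^ 9 + X3 ^ 9`, `k = k̄` of characteristic `p` with `2 ≠ 0`, `3 ≠ 0` in `k` (i.e. `p ∤ 18`), `v` = the vertex,
floor centre `𝔪 = (x̄, ȳ, ū, t̄, z̄)`, `A = 𝔪·K = genSet 5 B9NewtonKFan.AL2` (775 generators, `K` 𝔪-primary with `x^24, y^24, u^24, t^24, z^7 ∈ K`). THEN:
* §0 ★ `weaklyNondegenerate_b9` (`3 ≠ 0` in `k`) — `f` is WEAKLY (Tjurina) non-degenerate along every positive weight: designated vertex `β₀ = 2e_z`, good exponents `x⁹, y⁹, u⁹, t⁹`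
  in private variables with `9 ≢ 0` (ONE application of ✓ `CensusBedsWeaklyNondegenerate.weaklyNondegenerate_of_good_support`);
* §1 `exists_refining_strictTransform` — `θ_{V c} f = Y^{V c·u₀ c} · g_c`, `g_c(0) ≠ 0` on the 25 charts (Newton chart lemma on the tabulated minimisers);
* §2 `affineBlowup_mK_fullCl_b9` — `Bl_{𝔪·K} X` is `FullCl p` at EVERY point (✓ p656605 §2);
* §3 ★★★ `pointFloor_b9_row_class` — for EVERY blowing up `g : S′ → Spec 𝒪_{X,v}` along `𝔪·𝒪_{X,v}` there is `𝓚 ≠ ⊥` on `S′`, supported over the closed point, ALL of whose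
  blowings up are `FullCl p` at every stalk (✓ p656605 §3 `fHalfRow_of_weaklyNondegenerate`);
* §4 ★★★ `f4pos_rowB9` (`p ∤ 18`) / `f4pos_rowB9_of_ne` (`2, 3 ≠ 0`) — THE TWO-SIDED ROW in the census letter of ✓ p660468: LEGAL ∧ NOT F(4)-iso (p) ∧ CURED, conjoining
  res-L1-w45a-stub-1's ✓ `B9PointFloorNotFull.pointFloor_b9_input_legal` / `pointFloor_b9_not_full` with §3.
[OURS · certificate instance + assembly of landed theorems] [cite: IshiiSingularities2018, Thm. 4.4.23, Lemma 4.4.24, Cor. 4.4.25 (pp. 95–97)] [cite: BoubakriGreuelMarkwig2010, §3 (p. 10)]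
[cite: StacksProject, Tag 080A]
-/

-- single-problem summit: the doubled namespace component is forced
set_option linter.dupNamespace false

noncomputable section

open AlgebraicGeometry CategoryTheory Literature.AlgebraicGeometry.Resolution TopologicalSpace IsLocalRing MvPolynomial

namespace Summit.ResolutionOfSingularities.ResolutionOfSingularities.Theorems.FInjectiveMacaulayfication.B9PointFloorRowClass

open Summit.ResolutionOfSingularities.ResolutionOfSingularities.Theorems.FInjectiveMacaulayfication
open Literature.AlgebraicGeometry.Resolution.BoubakriGreuelMarkwig SliceableCentre FanCheckKit B9NewtonKFan CensusBedsWeaklyNondegenerate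

/-! ## §0 ★ Weak non-degeneracy of `f_B9` (only `3 ≠ 0` is needed) -/

/-- ★ **BED B9 `z² + x⁹ + y⁹ + u⁹ + t⁹` IS WEAKLY NON-DEGENERATE ALONG EVERY POSITIVE WEIGHT whenever `3 ≠ 0` in `k`** (`β₀ = 2e_z` designated — so NO hypothesis on `2`;
good exponents `x⁹, y⁹, u⁹, t⁹`, `9 = 3·3 ≠ 0`, in private variables). [OURS · elementary certificate; cite: BoubakriGreuelMarkwig2010, §3 (p. 10)] -/
theorem weaklyNondegenerate_b9 (k : Type) [Field k] (h3 : (3 : k) ≠ 0) (f : MvPolynomial (Fin 5) k)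
    (hf : f = X 4 ^ 2 + X 0 ^ 9 + X 1 ^ 9 + X 2 ^ 9 + X 3 ^ 9) :
    ∀ w : Fin 5 → ℝ, (∀ i, 0 < w i) → IsWeaklyNondegenerateAlong w (f : MvPowerSeries (Fin 5) k) := by
  classical
  have hsupp := support_subset k f hf
  have hf0 : f ≠ 0 := by
    intro h0
    have h := (single_mem_support k f hf).1
    rw [h0, support_zero] at h
    exact (Finset.notMem_empty _ h)
  have h9 : ((9 : ℕ) : k) ≠ 0 := by
    rw [show ((9 : ℕ) : k) = (3 : k) * 3 by norm_num]
    exact mul_ne_zero h3 h3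
  refine weaklyNondegenerate_of_good_support f hf0 (Finsupp.single 4 2) (fun α hα hne => ?_)
  rcases hsupp α hα with rfl | rfl | rfl | rfl | rfl
  · exact (hne rfl).elim
  · refine ⟨0, by simpa using h9, fun β hβ hβne => ?_⟩
    rcases hsupp β hβ with rfl | rfl | rfl | rfl | rfl
    · simp
    · exact (hβne rfl).elim
    · simp
    · simp
    · simp
  · refine ⟨1, by simpa using h9, fun β hβ hβne => ?_⟩
    rcases hsupp β hβ with rfl | rfl | rfl | rfl | rfl
    · simp
    · simp
    · exact (hβne rfl).elim
    · simp
    · simp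
  · refine ⟨2, by simpa using h9, fun β hβ hβne => ?_⟩
    rcases hsupp β hβ with rfl | rfl | rfl | rfl | rfl
    · simp
    · simp
    · simp
    · exact (hβne rfl).elim
    · simp
  · refine ⟨3, by simpa using h9, fun β hβ hβne => ?_⟩
    rcases hsupp β hβ with rfl | rfl | rfl | rfl | rfl
    · simp
    · simp
    · simp
    · simp
    · exact (hβne rfl).elim

/-! ## §1 The refining strict transforms from the Newton minimisers -/

/-- On every chart of the `Σ_f ∧ Σ(𝔪)` fan, `θ_{V c} f = Y^{V c · u₀ c} · g_c` with `g_c(0) ≠ 0` — the Newton chart lemma on the tabulated common minimiser (any field).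
[cite: IshiiSingularities2018, proof of Lemma 4.4.24 (p. 96)] -/
theorem exists_refining_strictTransform (k : Type) [Field k] (f : MvPolynomial (Fin 5) k) (hf : f = X 4 ^ 2 + X 0 ^ 9 + X 1 ^ 9 + X 2 ^ 9 + X 3 ^ 9) (c : Fin 25) :
    ∃ g : MvPolynomial (Fin 5) k, aeval (fun j : Fin 5 => ∏ i : Fin 5, (X i : MvPolynomial (Fin 5) k) ^ Vq c i j) f =
      monomial (Finsupp.equivFunOnFinite.symm ((Vq c).mulVec ⇑(Finsupp.equivFunOnFinite.symm (U0 c) : Fin 5 →₀ ℕ))) 1 * g ∧ constantCoeff g ≠ 0 :=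
  NewtonChartLemma.exists_theta_eq_monomial_mul_of_commonMinimiser (Vq c) (hV c) f _ (hu₀ k f hf c) (hmin k f hf c)

/-! ## §2 `Bl_{𝔪·K} X` is FULL everywhere (every `p ∤ 18`) -/

/-- ★ **`Bl_{𝔪·K} X_{B9}` IS `FullCl p` AT EVERY POINT**, for every prime `p` with `2, 3 ≠ 0` in `k = k̄` (class route). [OURS · certificate instance]
[cite: IshiiSingularities2018, Thm. 4.4.23 and Cor. 4.4.25] -/
theorem affineBlowup_mK_fullCl_b9 (p : ℕ) [Fact p.Prime] (k : Type) [Field k] [IsAlgClosed k] [CharP k p] (h2 : (2 : k) ≠ 0) (h3 : (3 : k) ≠ 0)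
    (f : MvPolynomial (Fin 5) k) (hf : f = X 4 ^ 2 + X 0 ^ 9 + X 1 ^ 9 + X 2 ^ 9 + X 3 ^ 9) :
    ∀ y : ↥(affineBlowup (Ideal.span ((fun e : Fin 5 →₀ ℕ => Ideal.Quotient.mk (Ideal.span {f}) (monomial e (1 : k))) '' (genSet 5 AL2 : Set (Fin 5 →₀ ℕ))))),
      FullCl p ((affineBlowup (Ideal.span ((fun e : Fin 5 →₀ ℕ => Ideal.Quotient.mk (Ideal.span {f}) (monomial e (1 : k))) '' (genSet 5 AL2 : Set (Fin 5 →₀ ℕ))))).presheaf.stalk y) := by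
  classical
  choose g hθ hg0 using exists_refining_strictTransform k f hf
  exact FHalfRowOfNewtonNondegenerate.affineBlowup_fullCl_of_weaklyNondegenerate p k f (B9Specimen.prime_f k h3 f hf)
    (weaklyNondegenerate_b9 k h3 f hf) (B9Specimen.mk_X_ne_zero k h3 f hf)
    (fun x hx => B9Specimen.regular_off_vertex k h2 h3 f hf x.asIdeal hx)
    (genSet 5 AL2) hprimAJ.2.1 hprimAJ.1 25 (chartM 5 AL2 CL 25) (hcov k) Vq hV (chartA 5 AL2 CL 25) haA hgen hge g _ hθ hg0 (B9NewtonKFan.hv k _)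

/-! ## §3 ★★★ The cure of the point floor, by the class theorem (every `p ∤ 18`) -/

/-- ★★★ **THE B9 POINT FLOOR IS CURED — BY THE CLASS THEOREM, FOR EVERY PRIME `p` WITH `2, 3 ≠ 0` IN `k = k̄`.** See the module docstring. [OURS · certificate instance]
[cite: IshiiSingularities2018, Thm. 4.4.23 and Cor. 4.4.25] [cite: StacksProject, Tag 080A] -/
theorem pointFloor_b9_row_class (p : ℕ) [Fact p.Prime] (k : Type) [Field k] [IsAlgClosed k] [CharP k p] (h2 : (2 : k) ≠ 0) (h3 : (3 : k) ≠ 0)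
    (f : MvPolynomial (Fin 5) k) (hf : f = X 4 ^ 2 + X 0 ^ 9 + X 1 ^ 9 + X 2 ^ 9 + X 3 ^ 9)
    (v : Spec (.of (MvPolynomial (Fin 5) k ⧸ Ideal.span {f})))
    (hv : v.asIdeal = Ideal.span (Set.range (fun j : Fin 5 => Ideal.Quotient.mk (Ideal.span {f}) (X j)))) :
    ∀ (S' : Scheme.{0}) (g : S' ⟶ Spec ((Spec (.of (MvPolynomial (Fin 5) k ⧸ Ideal.span {f}))).presheaf.stalk v)),
      IsBlowup g ((affineBlowup.idealSheaf (Ideal.span (Set.range (fun j : Fin 5 => Ideal.Quotient.mk (Ideal.span {f}) (X j))))).comap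
        ((Spec (.of (MvPolynomial (Fin 5) k ⧸ Ideal.span {f}))).fromSpecStalk v)) →
      ∃ 𝓚 : S'.IdealSheafData, 𝓚 ≠ ⊥ ∧
        (∀ s ∈ (𝓚.support : Set S'), g.base s = closedPoint ((Spec (.of (MvPolynomial (Fin 5) k ⧸ Ideal.span {f}))).presheaf.stalk v)) ∧
        ∀ (S'' : Scheme.{0}) (π : S'' ⟶ S'), IsBlowup π 𝓚 → ∀ s : S'', FullCl p (S''.presheaf.stalk s) := by
  classical
  choose g hθ hg0 using exists_refining_strictTransform k f hf
  exact FHalfRowOfNewtonNondegenerate.fHalfRow_of_weaklyNondegenerate p k (by norm_num) f (B9Specimen.prime_f k h3 f hf)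
    (weaklyNondegenerate_b9 k h3 f hf) (B9Specimen.mk_X_ne_zero k h3 f hf)
    (fun x hx => B9Specimen.regular_off_vertex k h2 h3 f hf x.asIdeal hx)
    (genSet 5 AL2) (genSet 5 KL2) (span_A_eq_floor_mul_K k _).1 hKprim.1 hprimAJ.2.1 hprimAJ.1 25 (chartM 5 AL2 CL 25) (hcov k) Vq hV
    (chartA 5 AL2 CL 25) haA hgen hge g _ hθ hg0 (B9NewtonKFan.hv k _) v hv

/-! ## §4 ★★★ The two-sided row, p-uniform -/

/-- ★★★ **ROW B9, p-UNIFORM (hypotheses `2 ≠ 0`, `3 ≠ 0` in `k = k̄` of characteristic `p`): LEGAL ∧ NOT F(4)-iso (p) ∧ CURED.** The first two conjuncts are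
res-L1-w45a-stub-1 g13's `B9PointFloorNotFull` (input side, p-uniform Fedder certificate), the third is §3. [OURS · assembly of landed theorems] -/
theorem f4pos_rowB9_of_ne (p : ℕ) [Fact p.Prime] (k : Type) [Field k] [IsAlgClosed k] [CharP k p] (h2 : (2 : k) ≠ 0) (h3 : (3 : k) ≠ 0)
    (f : MvPolynomial (Fin 5) k) (hf : f = X 4 ^ 2 + X 0 ^ 9 + X 1 ^ 9 + X 2 ^ 9 + X 3 ^ 9)
    (v : Spec (.of (MvPolynomial (Fin 5) k ⧸ Ideal.span {f})))
    (hv : v.asIdeal = Ideal.span (Set.range (fun j : Fin 5 => Ideal.Quotient.mk (Ideal.span {f}) (X j))))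
    (S' : Scheme.{0}) (g : S' ⟶ Spec ((Spec (.of (MvPolynomial (Fin 5) k ⧸ Ideal.span {f}))).presheaf.stalk v))
    (hg : IsBlowup g ((affineBlowup.idealSheaf (Ideal.span (Set.range (fun j : Fin 5 => Ideal.Quotient.mk (Ideal.span {f}) (X j))))).comap
      ((Spec (.of (MvPolynomial (Fin 5) k ⧸ Ideal.span {f}))).fromSpecStalk v))) :
    (((affineBlowup.idealSheaf (Ideal.span (Set.range (fun j : Fin 5 => Ideal.Quotient.mk (Ideal.span {f}) (X j))))).comap
        ((Spec (.of (MvPolynomial (Fin 5) k ⧸ Ideal.span {f}))).fromSpecStalk v)) ≠ ⊥ ∧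
      (((((affineBlowup.idealSheaf (Ideal.span (Set.range (fun j : Fin 5 => Ideal.Quotient.mk (Ideal.span {f}) (X j))))).comap
        ((Spec (.of (MvPolynomial (Fin 5) k ⧸ Ideal.span {f}))).fromSpecStalk v))).support :
          Set (Spec ((Spec (.of (MvPolynomial (Fin 5) k ⧸ Ideal.span {f}))).presheaf.stalk v))) ⊆
        (Scheme.regularLocus (Spec ((Spec (.of (MvPolynomial (Fin 5) k ⧸ Ideal.span {f}))).presheaf.stalk v)))ᶜ) ∧
      (∀ s : S', g.base s ≠ closedPoint ((Spec (.of (MvPolynomial (Fin 5) k ⧸ Ideal.span {f}))).presheaf.stalk v) → s ∈ Scheme.regularLocus S') ∧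
      (∀ s : S', CMCl (S'.presheaf.stalk s))) ∧
    (∃ s : S', g.base s = closedPoint ((Spec (.of (MvPolynomial (Fin 5) k ⧸ Ideal.span {f}))).presheaf.stalk v) ∧ ¬ FullCl p (S'.presheaf.stalk s)) ∧
    (∃ 𝓚 : S'.IdealSheafData, 𝓚 ≠ ⊥ ∧
      (∀ s ∈ (𝓚.support : Set S'), g.base s = closedPoint ((Spec (.of (MvPolynomial (Fin 5) k ⧸ Ideal.span {f}))).presheaf.stalk v)) ∧
      ∀ (S'' : Scheme.{0}) (π : S'' ⟶ S'), IsBlowup π 𝓚 → ∀ s : S'', FullCl p (S''.presheaf.stalk s)) :=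
  ⟨B9PointFloorNotFull.pointFloor_b9_input_legal k h2 h3 f hf v hv S' g hg, B9PointFloorNotFull.pointFloor_b9_not_full k p h3 f hf v hv S' g hg,
    pointFloor_b9_row_class p k h2 h3 f hf v hv S' g hg⟩

/-- In characteristic `p ∤ 18`, `2 ≠ 0` and `3 ≠ 0` in `k`. [folklore] -/
theorem two_three_ne_zero (p : ℕ) (k : Type) [Field k] [CharP k p] (hp : ¬ p ∣ 18) : (2 : k) ≠ 0 ∧ (3 : k) ≠ 0 := by
  refine ⟨fun h => hp ?_, fun h => hp ?_⟩
  · have h2 : p ∣ 2 := (CharP.cast_eq_zero_iff k p 2).mp (by exact_mod_cast h)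
    exact h2.trans ⟨9, by norm_num⟩
  · have h3' : p ∣ 3 := (CharP.cast_eq_zero_iff k p 3).mp (by exact_mod_cast h)
    exact h3'.trans ⟨6, by norm_num⟩

/-- ★★★ **ROW B9 IN THE CENSUS LETTER: `f4pos_rowB9 (p) (hp : p ∤ 18)`** — for EVERY prime `p ∤ 18` and `k = k̄` of characteristic `p`: for every blowing up `g : S′ → Spec 𝒪_{X,v}`
along the point floor, LEGAL ∧ NOT `FullCl p` somewhere over the closed point ∧ CURED by some `𝓚 ≠ ⊥` over the closed point all of whose blowings up are `FullCl p` everywhere —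
the first two-sided row of the F-half census not tied to `p ∈ {2, 3}`. [OURS · assembly of landed theorems] -/
theorem f4pos_rowB9 (p : ℕ) [Fact p.Prime] (hp : ¬ p ∣ 18) (k : Type) [Field k] [IsAlgClosed k] [CharP k p]
    (f : MvPolynomial (Fin 5) k) (hf : f = X 4 ^ 2 + X 0 ^ 9 + X 1 ^ 9 + X 2 ^ 9 + X 3 ^ 9)
    (v : Spec (.of (MvPolynomial (Fin 5) k ⧸ Ideal.span {f})))
    (hv : v.asIdeal = Ideal.span (Set.range (fun j : Fin 5 => Ideal.Quotient.mk (Ideal.span {f}) (X j))))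
    (S' : Scheme.{0}) (g : S' ⟶ Spec ((Spec (.of (MvPolynomial (Fin 5) k ⧸ Ideal.span {f}))).presheaf.stalk v))
    (hg : IsBlowup g ((affineBlowup.idealSheaf (Ideal.span (Set.range (fun j : Fin 5 => Ideal.Quotient.mk (Ideal.span {f}) (X j))))).comap
      ((Spec (.of (MvPolynomial (Fin 5) k ⧸ Ideal.span {f}))).fromSpecStalk v))) :
    (((affineBlowup.idealSheaf (Ideal.span (Set.range (fun j : Fin 5 => Ideal.Quotient.mk (Ideal.span {f}) (X j))))).comap
        ((Spec (.of (MvPolynomial (Fin 5) k ⧸ Ideal.span {f}))).fromSpecStalk v)) ≠ ⊥ ∧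
      (((((affineBlowup.idealSheaf (Ideal.span (Set.range (fun j : Fin 5 => Ideal.Quotient.mk (Ideal.span {f}) (X j))))).comap
        ((Spec (.of (MvPolynomial (Fin 5) k ⧸ Ideal.span {f}))).fromSpecStalk v))).support :
          Set (Spec ((Spec (.of (MvPolynomial (Fin 5) k ⧸ Ideal.span {f}))).presheaf.stalk v))) ⊆
        (Scheme.regularLocus (Spec ((Spec (.of (MvPolynomial (Fin 5) k ⧸ Ideal.span {f}))).presheaf.stalk v)))ᶜ) ∧
      (∀ s : S', g.base s ≠ closedPoint ((Spec (.of (MvPolynomial (Fin 5) k ⧸ Ideal.span {f}))).presheaf.stalk v) → s ∈ Scheme.regularLocus S') ∧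
      (∀ s : S', CMCl (S'.presheaf.stalk s))) ∧
    (∃ s : S', g.base s = closedPoint ((Spec (.of (MvPolynomial (Fin 5) k ⧸ Ideal.span {f}))).presheaf.stalk v) ∧ ¬ FullCl p (S'.presheaf.stalk s)) ∧
    (∃ 𝓚 : S'.IdealSheafData, 𝓚 ≠ ⊥ ∧
      (∀ s ∈ (𝓚.support : Set S'), g.base s = closedPoint ((Spec (.of (MvPolynomial (Fin 5) k ⧸ Ideal.span {f}))).presheaf.stalk v)) ∧
      ∀ (S'' : Scheme.{0}) (π : S'' ⟶ S'), IsBlowup π 𝓚 → ∀ s : S'', FullCl p (S''.presheaf.stalk s)) :=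
  f4pos_rowB9_of_ne p k (two_three_ne_zero p k hp).1 (two_three_ne_zero p k hp).2 f hf v hv S' g hg

/-! ## §5 The germ twin (p-uniform) -/

/-- ★ **THE GERM TWIN `b9_fInjectivizationGermAt`**: `FInjectivizationGermAt p v` for every prime `p` with `2, 3 ≠ 0` in `k = k̄` — the F-half's ∃-conclusion at the germ of
`X_{B9}` at its vertex, witnessed by `(𝔪·K)·𝒪_{X,v}` (all of whose blowings up are `FullCl p` everywhere by §2; `𝔪·K ≠ ⊥` and `𝔪 ⊆ √(𝔪·K)` from the pure powers in `A`).
[OURS · certificate instance; cite: GortzWedhorn2020, Prop. 13.91 (2)] -/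
theorem b9_fInjectivizationGermAt (p : ℕ) [Fact p.Prime] (k : Type) [Field k] [IsAlgClosed k] [CharP k p] (h2 : (2 : k) ≠ 0) (h3 : (3 : k) ≠ 0)
    (f : MvPolynomial (Fin 5) k) (hf : f = X 4 ^ 2 + X 0 ^ 9 + X 1 ^ 9 + X 2 ^ 9 + X 3 ^ 9)
    (v : Spec (.of (MvPolynomial (Fin 5) k ⧸ Ideal.span {f})))
    (hv : v.asIdeal = Ideal.span (Set.range (fun j : Fin 5 => Ideal.Quotient.mk (Ideal.span {f}) (X j)))) :
    GermForm.FInjectivizationGermAt p v := by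
  classical
  have hprime := B9Specimen.prime_f k h3 f hf
  haveI hp : (Ideal.span {f}).IsPrime := (Ideal.span_singleton_prime hprime.ne_zero).mpr hprime
  haveI : IsDomain (MvPolynomial (Fin 5) k ⧸ Ideal.span {f}) := Ideal.Quotient.isDomain _
  refine GermOfGlobalBlowup.fInjectivizationGermAt_of_affineBlowup p _ ?_ v ?_ (affineBlowup_mK_fullCl_b9 p k h2 h3 f hf)
  · obtain ⟨N, hN⟩ := hprimAJ.2.1 0 (Finset.mem_univ _)
    intro h0
    have hmem : Ideal.Quotient.mk (Ideal.span {f}) (monomial (Finsupp.single 0 N) (1 : k)) ∈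
        Ideal.span ((fun e : Fin 5 →₀ ℕ => Ideal.Quotient.mk (Ideal.span {f}) (monomial e (1 : k))) '' (genSet 5 AL2 : Set (Fin 5 →₀ ℕ))) :=
      Ideal.subset_span ⟨_, Finset.mem_coe.mpr hN, rfl⟩
    rw [h0, Ideal.mem_bot, ← X_pow_eq_monomial, map_pow] at hmem
    exact pow_ne_zero N (B9Specimen.mk_X_ne_zero k h3 f hf 0) hmem
  · rw [hv, Ideal.span_le]
    rintro _ ⟨j, rfl⟩
    obtain ⟨N, hN⟩ := hprimAJ.2.1 j (Finset.mem_univ _)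
    exact ⟨N, by rw [← map_pow, X_pow_eq_monomial]; exact Ideal.subset_span ⟨_, Finset.mem_coe.mpr hN, rfl⟩⟩

/-- The germ twin in the census letter `p ∤ 18`. [OURS · corollary] -/
theorem b9_fInjectivizationGermAt_of_not_dvd (p : ℕ) [Fact p.Prime] (hp : ¬ p ∣ 18) (k : Type) [Field k] [IsAlgClosed k] [CharP k p]
    (f : MvPolynomial (Fin 5) k) (hf : f = X 4 ^ 2 + X 0 ^ 9 + X 1 ^ 9 + X 2 ^ 9 + X 3 ^ 9)
    (v : Spec (.of (MvPolynomial (Fin 5) k ⧸ Ideal.span {f})))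
    (hv : v.asIdeal = Ideal.span (Set.range (fun j : Fin 5 => Ideal.Quotient.mk (Ideal.span {f}) (X j)))) :
    GermForm.FInjectivizationGermAt p v :=
  b9_fInjectivizationGermAt p k (two_three_ne_zero p k hp).1 (two_three_ne_zero p k hp).2 f hf v hv

end Summit.ResolutionOfSingularities.ResolutionOfSingularities.Theorems.FInjectiveMacaulayfication.B9PointFloorRowClass

end
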